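import Mathlib

/-!
# Bałaban's renormalization group for lattice gauge theories — the constants of the series and their printed dependences (`SeriesConstants`)

HONEST FRAMING (cell `lit-balaban`, unit r19, verbatim): statement-level skeleton of published theorems with citation tags;
proofs where landed; nothing here is a claim about the Yang–Mills mass gap.

CITATION HEADER.  T. Bałaban, *Comm. Math. Phys.* **89** 571–597 (1983) [Balaban1983RegularityDecay] (B4); **95** 17–40 (1984)
[Balaban1984PropagatorsI] (B5); **96** 223–250 (1984) [Balaban1984PropagatorsII] (B6); **99** 75–102 (1985)
[Balaban1985RegularSpaces] (B8); **99** 389–434 (1985) [Balaban1985BackgroundPropagators] (B9); **102** 255–275 (1985)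
[Balaban1985UV3] (B10); **102** 277–309 (1985) [Balaban1985Variational] (B11); **109** 249–301 (1987) [Balaban1987RG1] (B12);
**122** 355–392 (1989) [Balaban1989LargeFieldII] (B16).

PURPOSE (cross-paper CONSTANTS pass of the `lit-balaban` skeleton).  Every theorem of the series asserts the existence of
"positive constants" and says IN WORDS what they may depend on; those words decide the order of the quantifiers in any faithful
typing.  This module types the dependence sentences themselves, once, so that statements are not stringly-typed:

* a DEPENDENCE SIGNATURE is a record of exactly the parameters a constant may depend on (`SigD` = "on `d` only",
  `SigDM` = "on `d, M` only", `SigDL` = "on `d` and `L` only"), and a constant with that dependence is a POSITIVE FUNCTION of the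
  signature (`PosConst σ`); "independent of `A, k, Ω`" (B4 p. 573), "independent of `k, T_η`" (B5 p. 33), "independent of `X` and
  `j`" (B12 p. 263), "independent of `k, T_η, U_k`" (B16 p. 356) is then AUTOMATIC: the function does not take those arguments,
  and a statement quantifies over them after the constant has been applied to its signature.
  The papers' own glosses of "absolute constant" are recorded with the signatures: B8 p. 88 "an absolute constant `C'₁`, i.e.
  a constant depending on `d` and `L` only", B8 p. 92 "`B'₀` is an absolute constant (depending on `d` and `L` only)"; B12 p. 263
  "positive, absolute constants `α₀, α₁` (i.e., constants independent of `X` and `j`)"; B15 p. 186 "do not depend on any scale,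
  i.e., on `z, j, k`, and so on".
* one structure per printed "there exist positive constants …" sentence of the statements listed below, bundling the constants
  WITH THEIR SIGNATURES (fields typed `PosConst SigDM`, `SigD → ℝ → ℝ` for "`c₀` on `α` also", …), the verbatim sentence in the
  docstring: B4 Theorem p. 573, Prop. 2.3 p. 574, Prop. 3.1′ p. 574, Lemma 2.2 pp. 577–578; B5 Prop. 1.1 p. 33, Prop. 1.2
  pp. 35–36, the decay scale `M₀` p. 39; B6 Prop. 2.6 p. 247; B9 Thm. 3.1 p. 397; B11 Thm. 1 p. 279 (with the explicit
  `M(ε₁) = R₁ M₁ (a₁/ε₁)`); B12 (1.18) p. 263 and THEOREM 3 p. 264, whose sentence "The constants `ε₀, ε₁, α₀, α₁` depend on `M` …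
  The constant `γ` depends on all other constants" fixes the ORDER OF CHOICE `κ ≥ κ₀ → M ≥ M(κ) → (ε₀, ε₁, α₀, α₁)(M) → γ`,
  typed as nested functions (`B12Thm3Consts`, `B12Thm3Consts.Admissible`); B16 Thm. 1 p. 356.
* the EXPLICIT scale-dependent thresholds and radii as functions of `(L, η, j)`: B8 (1.7)–(1.10) p. 77 (regular spaces
  `𝔘_k({Ω_j}, α₀)`), B11 (9)–(10) p. 279 (regularity of the minimizers), B12 (1.2) p. 260 / (1.11), (1.14), (1.16)–(1.17)
  pp. 262–263 (spaces `U_k(ε₀)`, `Uᶜ_j(X, α₀, α₁, γ₀)`), and the logarithmic profiles B4 (1.21) p. 574 `p(e) = a₀(1 + log e⁻¹)^p`,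
  B10 (7) p. 257 `p(g) = b₀(1 + log g⁻¹)^{p₀}`, `r(g₀) = (1 + log g₀⁻¹)^{r₀}` (`oneLogProfile`; B14's `p₀(g) = A₀(log g⁻²)^{p₀}` is
  `Setup.p0Profile`, `ε_k`/`δ_k` are `Setup.epsK`/`Setup.deltaK`, `R_j` is `B14.IsRj`, not repeated), with their elementary API
  (positivity, monotonicity in the scale, the identity (1.7) = (1.8) of B8).

WHAT IS REPRODUCED: definitions and elementary lemmas only (each lemma carries the citation tag of the printed object it serves; none
is a statement of the papers); NO theorem of the series is asserted and no named fact is introduced.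
RELATION TO THE TREE (reviewers please note; nothing is re-declared): `Setup.Consts` is the bare record of the letters
`M, M₀, M₁, M₂, r, p₀, A₀, A₁, ε₀, ε₁, α₀, α₁, γ₀, γ, κ, E₀, α, N` of NOTATION §13 with the roles in comments and "dependences are
HYPOTHESES of the theorems that use them, never fixed here"; the present module is the complementary typed record of those
dependences.  B6's explicit constants `c₀(α) = Σ_{z∈ℤ} e^{−αδ₀|z|}`, `c₁(α) = 12 c₀(½α)^d` and the largeness condition (2.59) are
`B6.c0`, `B6.c1`, `B6.Cond259` (with `B6Lemma21Arith.one_le_c0`, …); the per-paper modules `B4.lean`, `B5.lean`, `B9.lean`,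
`B11Thm1.lean`, `B12.lean`, `B16.lean` state the theorems themselves (with the constants existentially quantified in their own
frames).  Value = typed vocabulary, not summit progress.
v1.2 (docstrings only; no declaration, statement or proof changed): cross-references naming the PRE-EXISTING decls of the tree that cite
the same printed locus (cell `lit-balaban` SAMELOCUS pre-check 2026-08-20), and a citation tag on the one `[folklore]` helper.
v1.3 (§4, append-only): the (Higgs)₂,₃ papers' signatures — "depending on `d, a, M` only" (B1 Prop. 2.1/2.2 p. 610–611), "dependent on
`d` and `a`" (B1 Prop. 2.3 p. 611), B3 Prop. 1 p. 420–421 ("`δ₀` depends on `d` only … `O(1)` depends on `α₀, n̄`") — as `SigDA`, `SigDAM`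
and the bundles `B1Prop21Consts`, `B1Prop22Consts`, `B1Prop23Consts`, `B3Prop1Consts`; the statements themselves are the pre-existing
`B1.Prop21Printed`/`Prop21Uniform`, `B1.Prop22Literal`, `B1.Prop23Literal`, `B3Prop1.Prop1` (constants existential in their frames).
v1.4 (docstring only; no declaration, statement or proof changed): the page locator of the `B1Prop23Consts` citation tag corrected from
«(2.33)–(2.38) p.611» to «pp.611–612» — the Proposition 2.3 sentence and (2.33)–(2.35) are printed on p. 611, (2.36)–(2.38) on p. 612
(checked on the held text `paper:balaban1982-cmp85-higgs23-i`, PDF pp. 9–10 = pp. 611–612; cell `lit-balaban` cross-read finding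
`lit-balaban-r12/CITELOC-SWEEP-B1B2B3-g16.md` §2a «SeriesConstants:638 (r19)», fixed by the owner seat r19 gen 14).
-/

open scoped BigOperators

namespace Literature.MathematicalPhysics.QuantumFieldTheory.Balaban1983to89

namespace SeriesConstants

noncomputable section

/-! ## 1. Dependence signatures and positive constants -/

/-- Dependence signature "on `d` only" (B5 Prop. 1.1 p. 33: "a positive constant `γ₀` independent of `k, T_η`, and depending on
`d` only"; B5 Prop. 1.2 p. 35: "`δ₀` depending on `d` only"; B5 p. 39: "we can fix `M₀` depending on `d` only"; B4 Prop. 3.1′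
p. 574: "`γ₀` depending on `d` only"; B9 p. 405: "`O(1)` is an absolute constant depending on `d` only").
Pre-existing per-statement records of such sentences (v1.2 cross-reference): `B5Bound128Uniform.kV_decay` ("the constant `O(1)` in
(1.126) depends on `d` only"), `B5Bound128Uniform.twoDelta0_div`, `B5DPD126Uniform`, `B5DPD127HolderUniform` — each an `∃ C`
INSIDE one theorem; this structure is the argument type such a `C` is a function of.
[cite: Balaban1984PropagatorsI, Proposition 1.2 p.35] -/
structure SigD where
  /-- the dimension `d` -/
  d : ℕ

/-- Dependence signature "on `d, M` only" (B4 Theorem p. 573: "positive constants `δ₀, c₀, R₀` independent of `A, k, Ω` and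
depending on `d, M` only"; B4 Prop. 2.3 p. 574: "`δ₀, c₀, γ₀, γ₁` dependent on `d` and `M` only"), `M` the size of the big blocks
of B4 (1.1) p. 572. [cite: Balaban1983RegularityDecay, Theorem p.573] -/
structure SigDM where
  /-- the dimension `d` -/
  d : ℕ
  /-- the big-block size `M` -/
  M : ℕ

/-- Dependence signature "on `d` and `L` only" — the series' "ABSOLUTE constants" from B6 on: B6 Prop. 2.6 p. 247 "`δ₃` depending
on `d` and `L` only"; B8 p. 77 "`δ₀` is a decay rate of propagators, and it depends on `d` and `L` only", p. 88 "an absolute constant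
`C'₁`, i.e. a constant depending on `d` and `L` only" ((1.67); (1.111) p. 95: `C'₁ = (2 + 16B'₀)L`), p. 92 "`B'₀` is an absolute
constant (depending on `d` and `L` only)";
B9 Thm. 3.1 p. 397 "`M₁, δ₀, a₀, B₀` dependent on `d` and `L` only"; B11 Thm. 1 p. 279 "`a₀, a₁, B₃` depend on `d` and `L` only".
[cite: Balaban1985RegularSpaces, p.88] -/
structure SigDL where
  /-- the dimension `d` -/
  d : ℕ
  /-- the block size `L` of the averaging operations -/
  L : ℕ

/-- Forgetting the block size: a constant depending on `d` only is in particular one depending on `d` and `L`. [cite: Balaban1985RegularSpaces, p.88] -/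
def SigDL.toSigD (s : SigDL) : SigD := ⟨s.d⟩

/-- Forgetting the big-block size. [cite: Balaban1983RegularityDecay, Theorem p.573] -/
def SigDM.toSigD (s : SigDM) : SigD := ⟨s.d⟩

/-- A POSITIVE CONSTANT WITH DEPENDENCE SIGNATURE `σ`: a positive real-valued function of exactly the parameters it may depend on.
"Independent of" everything else is automatic (the function takes no other argument).  This is the typed form of the series'
standing phrase "there exists a positive constant … depending on … only". [cite: Balaban1983RegularityDecay, Theorem p.573] -/
structure PosConst (σ : Type*) where
  /-- the value of the constant at the given parameters -/
  val : σ → ℝ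
  /-- positivity -/
  pos : ∀ s, 0 < val s

namespace PosConst

variable {σ : Type*}

/-- A positive constant is nonnegative. [cite: Balaban1983RegularityDecay, Theorem p.573] -/
lemma nonneg (c : PosConst σ) (s : σ) : 0 ≤ c.val s := (c.pos s).le

/-- A positive constant is nonzero. [cite: Balaban1983RegularityDecay, Theorem p.573] -/
lemma ne_zero (c : PosConst σ) (s : σ) : c.val s ≠ 0 := (c.pos s).ne'

/-- A constant independent of everything (a numerical constant), as a `PosConst` of any signature. [cite: Balaban1983RegularityDecay, Theorem p.573] -/
def const (c : ℝ) (hc : 0 < c) : PosConst σ := ⟨fun _ => c, fun _ => hc⟩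

/-- Pulling a constant back along a forgetful map of signatures (a constant depending on `d` only IS a constant depending on
`d, L`): `c.comap SigDL.toSigD`. [cite: Balaban1983RegularityDecay, Theorem p.573] -/
def comap {τ : Type*} (c : PosConst σ) (f : τ → σ) : PosConst τ := ⟨fun t => c.val (f t), fun t => c.pos (f t)⟩

/-- Value of a pulled-back constant. [cite: Balaban1983RegularityDecay, Theorem p.573] -/
@[simp] lemma comap_val {τ : Type*} (c : PosConst σ) (f : τ → σ) (t : τ) : (c.comap f).val t = c.val (f t) := rfl

end PosConst

/-- A constant that depends on a signature `σ` AND on a real parameter restricted to a range (the Hölder exponent `α < 1` of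
B4 p. 573 "`c₀` on `α` also", `0 ≤ α < 1` of B5 (1.111), `ε ∈ ]0,1[` of B5 (1.112), `β ∈ [0,1[` of B9 Thm. 3.1 "`B₀(β)`
(`B₀(β) → ∞` if `β → 1`)"): positive on the printed range `ok`, unconstrained (junk) outside it.  The blow-up remarks
"`O(1) → ∞` if `α → 1`" are not typed (they assert NON-uniformity and are never used as hypotheses).
[cite: Balaban1985BackgroundPropagators, Theorem 3.1 p.397] -/
structure PosConstOn (σ : Type*) (ok : ℝ → Prop) where
  /-- the value at the parameters and the real argument -/
  val : σ → ℝ → ℝ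
  /-- positivity on the admissible range of the real argument -/
  pos : ∀ s t, ok t → 0 < val s t

/-- A constant positive on a range is nonnegative there. [cite: Balaban1985BackgroundPropagators, Theorem 3.1 p.397] -/
lemma PosConstOn.nonneg {σ : Type*} {ok : ℝ → Prop} (c : PosConstOn σ ok) (s : σ) {t : ℝ} (ht : ok t) :
    0 ≤ c.val s t := (c.pos s t ht).le

/-- The printed ranges of the real parameters: Hölder exponents `α < 1` (B4 p. 573, p. 577). [cite: Balaban1983RegularityDecay, Theorem p.573] -/
def HolderRange (α : ℝ) : Prop := α < 1

/-- `0 ≤ α < 1` (B5 (1.111) p. 35, B6 (2.137) p. 247, B9 Thm. 3.1 `0 ≤ β < 1`).  Pre-existing decls at the locus (1.111)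
(v1.2 cross-reference): the inequality itself is `B5FromB4.H1Entry`/`GpHolder`, `B5Ineq110Gp.Ineq111At/Ineq111Pair`
(`ineq111At_of_display135`), `B5Transfer132.h1Entry_of_pieces`; this is only its parameter range.
[cite: Balaban1984PropagatorsI, (1.111) p.35] -/
def HolderRange₀ (α : ℝ) : Prop := 0 ≤ α ∧ α < 1

/-- `0 < ε < 1` (B5 (1.112) p. 36, B6 (2.138) p. 247).  Pre-existing decls at the locus (1.112) (v1.2 cross-reference): the
inequality itself is `B5FromB4.E4Entry`/`SecondOrderFam`, `B5Ineq137.e4Entry_of_ineq137`, `B5Transfer132.e4Entry_of_pieces`; this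
is only its parameter range. [cite: Balaban1984PropagatorsI, (1.112) p.36] -/
def EpsRange (ε : ℝ) : Prop := 0 < ε ∧ ε < 1

/-- `0 < ε ≤ 1` — the parameter range printed for B9 Thm. 3.1's `B'₀(ε)`, `B'₀(ε, β)` (p. 398: *"`0 < ε ≤ 1, 0 ≤ β < 1`"*; (3.44):
*"for `0 < ε ≤ 1`"*), which, unlike B5 (1.112) / B6 (2.138), INCLUDES `ε = 1` (pre-existing decl at the locus (3.44):
`B9FromB6.E4Block`, the inequality itself; v1.2 cross-reference). [cite: Balaban1985BackgroundPropagators, (3.44) p.398] -/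
def EpsRange₁ (ε : ℝ) : Prop := 0 < ε ∧ ε ≤ 1

/-- The open range is contained in the closed one. [cite: Balaban1985BackgroundPropagators, (3.44) p.398] -/
lemma EpsRange.toEpsRange₁ {ε : ℝ} (h : EpsRange ε) : EpsRange₁ ε := ⟨h.1, h.2.le⟩

/-! ## 2. The constants of the individual statements, with their signatures -/

/-- B4 Theorem p. 573 (= "Proposition 2.1 of [1]"), verbatim: *"For `α < 1` there exist positive constants `δ₀, c₀, R₀` independent
of `A, k, Ω` and depending on `d, M` only, `c₀` on `α` also, such that for `e` sufficiently small …"*; p. 578 (2.19):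
*"`R₀ = (diameter of ⋃_ω ⋃_i □_{ω_i}) + 2M` … it follows that `R₀` depends on `M` and `n₀`"*, `n₀ = d`.
Pre-existing decls (v1.2 cross-reference): the statement is `B4.ThmPrinted` (constants existentially quantified in its frame); the
(2.19) mechanism fixing `R₀` is `B4LpChain221.reach_219`/`good_of_reach`; this structure is the typed dependence of the three letters.
[cite: Balaban1983RegularityDecay, Theorem p.573] -/
structure B4ThmConsts where
  /-- the decay rate `δ₀(d, M)` -/
  δ₀ : PosConst SigDM
  /-- the boundary-distance threshold `R₀(d, M)` of the conditions `dist(·, Ωᶜ) ≥ R₀` -/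
  R₀ : PosConst SigDM
  /-- the prefactor `c₀(d, M; α)`, `α < 1` -/
  c₀ : PosConstOn SigDM HolderRange

/-- B4 Proposition 2.3 (of [1]) p. 574, verbatim: *"There exist positive constants `δ₀, c₀, γ₀, γ₁` dependent on `d` and `M` only and
such that for arbitrary `Λ ⊂ Ω^{(k)}` … and for `e` sufficiently small, we have"* (1.15)–(1.20).
[cite: Balaban1983RegularityDecay, Proposition 2.3 p.574] -/
structure B4Prop23Consts where
  /-- decay rate `δ₀(d, M)` in (1.16), (1.18), (1.20) -/
  δ₀ : PosConst SigDM
  /-- prefactor `c₀(d, M)` -/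
  c₀ : PosConst SigDM
  /-- lower bound `γ₀(d, M)` in (1.15) -/
  γ₀ : PosConst SigDM
  /-- upper bound `γ₁(d, M)` in (1.15) -/
  γ₁ : PosConst SigDM

/-- B4 Proposition 3.1′ (of [2]) p. 574, verbatim: *"then there exists a positive constant `γ₀` depending on `d` only, such that for
`e` sufficiently small"* (1.22) *"for arbitrary `α > 0` and a constant `O(1)` depending on `α` and the other constants, but
independent of `Ω, k, A`, and for an arbitrary function `φ`."* [cite: Balaban1983RegularityDecay, Proposition 3.1′ p.574] -/
structure B4Prop31Consts where
  /-- the lower bound `γ₀(d)` of (1.22) -/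
  γ₀ : PosConst SigD
  /-- the constant `O(1)(d; α)` of the correction term `O(1) e^{2−α} Σ|φ(x)|²`, `α > 0` -/
  O1 : PosConstOn SigD (fun α => 0 < α)

/-- B4 Lemma 2.2 pp. 577–578, verbatim: *"for `e` sufficiently small and `α < 1`, there exists a constant `c₁` depending on `d, α` only,
such that `‖G_k(□, Ã) f‖_{1,α} ≤ c₁ ‖f‖_∞` (2.16) and a constant `c₂` depending on `d, p₁`, such that"* (2.17) *"for
`1 ≤ p, q ≤ ∞`, satisfying the condition `1/p − 1/p₁ ≤ 1/q ≤ 1/p` with `p₁ > d`."* [cite: Balaban1983RegularityDecay, Lemma 2.2 p.577] -/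
structure B4Lemma22Consts where
  /-- `c₁(d; α)`, `α < 1` -/
  c₁ : PosConstOn SigD HolderRange
  /-- `c₂(d; p₁)`, `p₁ > d` (positivity demanded for every `p₁`; the statement uses it only for `p₁ > d`) -/
  c₂ : PosConst (SigD × ℝ)

/-- B5 Proposition 1.1 p. 33, verbatim: *"`‖GJ‖, ‖∇GJ‖, ‖G∇*J‖, ‖∇G∇*J‖, ‖∇∇GJ‖, ‖G∇*∇*J‖ ≤ γ₀⁻¹ ‖J‖` (1.89) with a positive
constant `γ₀` independent of `k, T_η`, and depending on `d` only (if we put `a = 1`)."* [cite: Balaban1984PropagatorsI, Proposition 1.1 p.33] -/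
structure B5Prop11Consts where
  /-- `γ₀(d)` -/
  γ₀ : PosConst SigD

/-- B5 Proposition 1.2 pp. 35–36, verbatim: *"There exists a positive constant `δ₀` depending on `d` only, such that"* (1.110)
*"with the constant `O(1)` depending on `d` only"*, (1.111) *"for `0 ≤ α < 1` … with the constant `O(1)` depending on `d` and
`α` (`O(1) → ∞` if `α → 1`)"*, (1.112) *"for `0 < ε < 1` … depending on `d` and `ε` (`O(1) → ∞` if `ε → 0`)"*, (1.113) *"for
`0 ≤ α < 1, ε > 0, α + ε < 1` … depending on `d, α` and `ε`"*, (1.114) *"Finally there exists a constant `O(1)` such that"* (p. 36: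
"and (1.89), with the same dependence of the constants `O(1)`"); p. 39: *"we can fix `M₀` depending on `d` only"* (the size
`M₀ = L^{m₀}` of the cubes of the random-walk expansion, p. 36). [cite: Balaban1984PropagatorsI, Proposition 1.2 p.35] -/
structure B5Prop12Consts where
  /-- the decay rate `δ₀(d)` -/
  δ₀ : PosConst SigD
  /-- `O(1)(d)` of (1.110) -/
  C110 : PosConst SigD
  /-- `O(1)(d; α)` of (1.111), `0 ≤ α < 1` -/
  C111 : PosConstOn SigD HolderRange₀
  /-- `O(1)(d; ε)` of (1.112), `0 < ε < 1` -/
  C112 : PosConstOn SigD EpsRange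
  /-- `O(1)(d; α, ε)` of (1.113), `0 ≤ α`, `0 < ε`, `α + ε < 1` (one real slot per parameter) -/
  C113 : SigD → ℝ → ℝ → ℝ
  /-- positivity of `C113` on the printed range -/
  C113_pos : ∀ s α ε, 0 ≤ α → 0 < ε → α + ε < 1 → 0 < C113 s α ε
  /-- `O(1)(d)` of the `L²` bounds (1.114) -/
  C114 : PosConst SigD
  /-- the random-walk cube size `M₀(d)` (a power of `L`; p. 36 `M₀ = L^{m₀}`) -/
  M₀ : SigD → ℕ
  /-- `M₀ ≥ 1` -/
  M₀_pos : ∀ s, 0 < M₀ s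

/-- B6 Proposition 2.6 p. 247, verbatim: *"There exists a positive constant `δ₃` depending on `d` and `L` only, such that"* (2.136)
*"with the constant `O(1)` depending on `d` and `L` only"*, (2.137) *"depending on `d, L` and `α` (`O(1) → ∞` if `α → 1`)"*, (2.138)
*"depending on `d, L`, and `ε` (`O(1) → ∞` if `ε → 0`)"*, (2.139) *"depending on `d, L, α`, and `ε`"*, (2.140) *"depending on `d`
and `L`"*. [cite: Balaban1984PropagatorsII, Proposition 2.6 p.247] -/
structure B6Prop26Consts where
  /-- the decay rate `δ₃(d, L)` -/
  δ₃ : PosConst SigDL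
  /-- `O(1)(d, L)` of (2.136) -/
  C136 : PosConst SigDL
  /-- `O(1)(d, L; α)` of (2.137) -/
  C137 : PosConstOn SigDL HolderRange₀
  /-- `O(1)(d, L; ε)` of (2.138) -/
  C138 : PosConstOn SigDL EpsRange
  /-- `O(1)(d, L; α, ε)` of (2.139) -/
  C139 : SigDL → ℝ → ℝ → ℝ
  /-- positivity of `C139` on the printed range -/
  C139_pos : ∀ s α ε, 0 ≤ α → 0 < ε → α + ε < 1 → 0 < C139 s α ε
  /-- `O(1)(d, L)` of the `L²` bounds (2.140) -/
  C140 : PosConst SigDL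

/-- B9 Theorem 3.1 p. 397, verbatim: *"There exist positive constants `M₁, δ₀, a₀, B₀` dependent on `d` and `L` only, a constant `B₀(β)`
dependent on `d, L` and `β`, `0 ≤ β < 1` (`B₀(β) → ∞` if `β → 1`), such that for `M ≥ M₁` and for an arbitrary configuration `U`
satisfying the regularity condition (3.35) with `M α₀ ≤ a₀`, the operator `G'(U)` (`a = 1`) satisfies the inequalities"* (3.42) ff.
— p. 398, verbatim: *"Furthermore, there exist constants `B'₀(ε), B'₀(ε, β)` dependent on `d, L` and the indicated parameters,
`0 < ε ≤ 1`, `0 ≤ β < 1` (`B'₀(ε) → ∞` if `ε → 0`, `B'₀(ε, β) → ∞` if either `ε → 0`, or `β → 1`), such that"* (3.44)–(3.45).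
The bound constants `B₀(β)`, `B'₀(ε)`, `B'₀(ε, β)` are printed as "constants" bounding non-negative quantities from above, so they
are recorded positive without loss (v1.1: parameter ranges of `B'₀(ε)`, `B'₀(ε, β)` as printed on p. 398, render re-read —
`0 < ε ≤ 1` and `0 ≤ β < 1` independently, NOT the B5/B6 range `0 < ε < 1`, `β + ε < 1`).
[cite: Balaban1985BackgroundPropagators, Theorem 3.1 pp.397–398] -/
structure B9Thm31Consts where
  /-- the validity scale `M₁(d, L)` ("`M ≥ M₁`") -/
  M₁ : SigDL → ℕ
  /-- `M₁ ≥ 1` -/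
  M₁_pos : ∀ s, 0 < M₁ s
  /-- decay rate `δ₀(d, L)` -/
  δ₀ : PosConst SigDL
  /-- the regularity budget `a₀(d, L)` of the hypothesis `M α₀ ≤ a₀` -/
  a₀ : PosConst SigDL
  /-- `B₀(d, L)` -/
  B₀ : PosConst SigDL
  /-- `B₀(d, L; β)`, `0 ≤ β < 1` -/
  B₀β : PosConstOn SigDL HolderRange₀
  /-- `B'₀(d, L; ε)`, `0 < ε ≤ 1` (p. 398, (3.44); "`B'₀(ε) → ∞` if `ε → 0`") -/
  B₀'ε : PosConstOn SigDL EpsRange₁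
  /-- `B'₀(d, L; ε, β)`, `0 < ε ≤ 1`, `0 ≤ β < 1` (p. 398, (3.45); "`→ ∞` if either `ε → 0`, or `β → 1`") -/
  B₀'εβ : SigDL → ℝ → ℝ → ℝ
  /-- positivity of `B'₀(ε, β)` on the printed parameter range `0 < ε ≤ 1`, `0 ≤ β < 1` -/
  B₀'εβ_pos : ∀ s ε β, EpsRange₁ ε → HolderRange₀ β → 0 < B₀'εβ s ε β

/-- The HYPOTHESIS side of B9 Thm. 3.1 with these constants: `M ≥ M₁(d, L)` and `M α₀ ≤ a₀(d, L)`. [cite: Balaban1985BackgroundPropagators, Theorem 3.1 p.397] -/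
def B9Thm31Consts.Admissible (C : B9Thm31Consts) (s : SigDL) (M : ℕ) (α₀ : ℝ) : Prop :=
  C.M₁ s ≤ M ∧ (M : ℝ) * α₀ ≤ C.a₀.val s

/-- B11 Theorem 1 p. 279, verbatim: *"There exist positive constants `a₀, a₁, B₃, B₄(β₀), M(ε₁)`, `B₃ a₁ ≤ a₀`, such that for an
arbitrary configuration `V` satisfying (7) with `ε₁ ≤ a₁` there exists a minimal orbit … This orbit is a unique critical orbit in
the space (6) if `B₃ ε₁ ≤ ε₀` and `ε₀ ≤ a₀`. … The constants `a₀, a₁, B₃`, depend on `d` and `L` only, the constants `B₄(β₀), M(ε₁)`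
depend on the indicated parameters also. More exactly `M(ε₁) = R₁ M₁ (a₁/ε₁)`."* [cite: Balaban1985Variational, Theorem 1 p.279] -/
structure B11Thm1Consts where
  /-- `a₀(d, L)` -/
  a₀ : PosConst SigDL
  /-- `a₁(d, L)` -/
  a₁ : PosConst SigDL
  /-- `B₃(d, L)` -/
  B₃ : PosConst SigDL
  /-- the printed restriction `B₃ a₁ ≤ a₀` -/
  B₃a₁_le : ∀ s, B₃.val s * a₁.val s ≤ a₀.val s
  /-- `B₄(d, L; β₀)`, the Hölder exponent bound `β₀` of (9) (`0 ≤ β ≤ β₀`) -/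
  B₄ : PosConstOn SigDL (fun β₀ => 0 ≤ β₀)
  /-- the scales `R₁(d, L)`, `M₁(d, L)` of the domains (1) p. 277 ("fixed in such a way that all the results of [3, 5, 6] hold") -/
  R₁ : SigDL → ℕ
  /-- see `R₁` -/
  M₁ : SigDL → ℕ
  /-- `R₁, M₁ ≥ 1` -/
  R₁_pos : ∀ s, 0 < R₁ s
  /-- see `R₁_pos` -/
  M₁_pos : ∀ s, 0 < M₁ s

/-- B11 p. 279: "More exactly `M(ε₁) = R₁ M₁ (a₁/ε₁)`" — the admissible cube size as an explicit function of `ε₁`.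
[cite: Balaban1985Variational, Theorem 1 p.279] -/
def B11Thm1Consts.Mε₁ (C : B11Thm1Consts) (s : SigDL) (ε₁ : ℝ) : ℝ := C.R₁ s * C.M₁ s * (C.a₁.val s / ε₁)

/-- `M(ε₁) > 0` for `ε₁ > 0`. [cite: Balaban1985Variational, Theorem 1 p.279] -/
lemma B11Thm1Consts.Mε₁_pos (C : B11Thm1Consts) (s : SigDL) {ε₁ : ℝ} (hε : 0 < ε₁) : 0 < C.Mε₁ s ε₁ := by
  unfold B11Thm1Consts.Mε₁
  have h1 : (0 : ℝ) < C.R₁ s := Nat.cast_pos.mpr (C.R₁_pos s)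
  have h2 : (0 : ℝ) < C.M₁ s := Nat.cast_pos.mpr (C.M₁_pos s)
  exact mul_pos (mul_pos h1 h2) (div_pos (C.a₁.pos s) hε)

/-- The HYPOTHESIS side of B11 Thm. 1 for a choice `(ε₀, ε₁)` of radii: existence needs `ε₁ ≤ a₁`; uniqueness needs in addition
`B₃ ε₁ ≤ ε₀ ≤ a₀` (p. 279). [cite: Balaban1985Variational, Theorem 1 p.279] -/
def B11Thm1Consts.Admissible (C : B11Thm1Consts) (s : SigDL) (ε₀ ε₁ : ℝ) : Prop :=
  0 < ε₁ ∧ ε₁ ≤ C.a₁.val s ∧ C.B₃.val s * ε₁ ≤ ε₀ ∧ ε₀ ≤ C.a₀.val s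

/-- B12 (1.18) p. 263, verbatim: *"There exists a constant `E₀` such that `|E^{(j)}(X, g_{j−1}, U, J)| ≤ E₀ exp(−κ d_j(X))` (1.18) for
`M ≥ M(κ)`, `γ` sufficiently small, and for all configurations `(U, J) ∈ Uᶜ_j(X, α₀, α₁)`"*; p. 257 (0.25): *"with a sufficiently
large constant `κ`"*; p. 263: *"positive, absolute constants `α₀, α₁` (i.e., constants independent of `X` and `j`) … `g_{j−1} ∈
[0, γ]` … with a positive, absolute `γ`."*  The typed content: `E₀`, `κ`, `α₀`, `α₁`, `γ` are fixed BEFORE `X` and `j`; `M(κ)` is a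
function of `κ`. [cite: Balaban1987RG1, (1.18) p.263] -/
structure B12Ineq118Consts where
  /-- the prefactor `E₀` -/
  E₀ : ℝ
  /-- `E₀ > 0` -/
  E₀_pos : 0 < E₀
  /-- the decay rate `κ` of `exp(−κ d_j(X))` -/
  κ : ℝ
  /-- `κ > 0` -/
  κ_pos : 0 < κ
  /-- the scale `M(κ)` from which on (1.18) holds -/
  Mκ : ℝ → ℕ
  /-- the radii `α₀, α₁` of `Uᶜ_j(X, α₀, α₁)` ("absolute": independent of `X` and `j`) -/
  α₀ : ℝ
  /-- see `α₀` -/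
  α₁ : ℝ
  /-- the coupling interval `]0, γ]` -/
  γ : ℝ
  /-- positivity of the radii and of `γ` -/
  radii_pos : 0 < α₀ ∧ 0 < α₁ ∧ 0 < γ

/-- B12 THEOREM 3 p. 264, verbatim: *"There exist positive constants `κ₀, M(κ), γ, ε₀, ε₁, α₀, α₁` such, that if `κ ≥ κ₀`,
`M ≥ M(κ)`, `0 < g_k ≤ γ` for `k = 0, 1, …, K`, then the sequence of actions `A_k`, defined inductively by the small field
renormalization transformations (0.17)–(0.20), satisfy all the inductive assumptions described between (1.1)–(1.22). The
constants `ε₀, ε₁, α₀, α₁` depend on `M` and satisfy numerous restrictions, which will become clear in the proof. The constant `γ`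
depends on all other constants."*  TYPED ORDER OF CHOICE: `κ₀`; `κ ↦ M(κ)`; `M ↦ (ε₀, ε₁, α₀, α₁)(M)`; `(κ, M) ↦ γ(κ, M)`.
(The dependence of everything on `d = 4`, `L` and the group is suppressed in B12, which fixes them on p. 251; a user wanting
it explicit instantiates one such record per `(d, L, G)`.) [cite: Balaban1987RG1, Theorem 3 p.264] -/
structure B12Thm3Consts where
  /-- the threshold `κ₀` for the decay rate -/
  κ₀ : ℝ
  /-- `κ₀ > 0` -/
  κ₀_pos : 0 < κ₀
  /-- `M(κ)`: the localization-cube size from which on the theorem holds at decay rate `κ` -/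
  Mκ : ℝ → ℕ
  /-- `ε₀(M)`: radius of the real regular space `U_k(ε₀)` (1.2) -/
  ε₀ : ℕ → ℝ
  /-- `ε₁(M)` -/
  ε₁ : ℕ → ℝ
  /-- `α₀(M)`: radius of the complex spaces `Uᶜ_j(X, α₀, α₁)` (1.11)–(1.14) -/
  α₀ : ℕ → ℝ
  /-- `α₁(M)` -/
  α₁ : ℕ → ℝ
  /-- positivity of the four radii for every `M` -/
  radii_pos : ∀ M, 0 < ε₀ M ∧ 0 < ε₁ M ∧ 0 < α₀ M ∧ 0 < α₁ M
  /-- `γ(κ, M)`: "The constant `γ` depends on all other constants" — the other constants being `κ`, `M` and the four radii,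
  themselves functions of `M` -/
  γ : ℝ → ℕ → ℝ
  /-- `γ > 0` -/
  γ_pos : ∀ κ M, 0 < γ κ M

/-- The HYPOTHESIS side of B12 Thm. 3 for given `(κ, M)` and a coupling sequence `g` up to step `K`:
"`κ ≥ κ₀`, `M ≥ M(κ)`, `0 < g_k ≤ γ` for `k = 0, 1, …, K`". [cite: Balaban1987RG1, Theorem 3 p.264] -/
def B12Thm3Consts.Admissible (C : B12Thm3Consts) (κ : ℝ) (M : ℕ) (g : ℕ → ℝ) (K : ℕ) : Prop :=
  C.κ₀ ≤ κ ∧ C.Mκ κ ≤ M ∧ ∀ k ≤ K, 0 < g k ∧ g k ≤ C.γ κ M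

/-- Admissibility is inherited by shorter runs. [cite: Balaban1987RG1, Theorem 3 p.264] -/
lemma B12Thm3Consts.Admissible.mono (C : B12Thm3Consts) {κ : ℝ} {M : ℕ} {g : ℕ → ℝ} {K K' : ℕ} (hK : K' ≤ K)
    (h : C.Admissible κ M g K) : C.Admissible κ M g K' :=
  ⟨h.1, h.2.1, fun k hk => h.2.2 k (hk.trans hK)⟩

/-- B16 Theorem 1 p. 355–356 (the end-statement of the series; `B16.EndStatementBPrinted` in the tree), the constant sentence
verbatim p. 356: *"with the constants `E₋, E₊` independent of `k, T_η, U_k`."*  Typed content: two reals fixed before the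
quantifiers over the step `k`, the torus `T_η` and the background `U_k` (what they DO depend on — `d`, `L`, the group, `M`, … —
is not printed and not asserted here). [cite: Balaban1989LargeFieldII, Theorem 1 p.356] -/
structure B16Thm1Consts where
  /-- the lower constant `E₋` -/
  Eminus : ℝ
  /-- the upper constant `E₊` -/
  Eplus : ℝ

/-! ## 3. Explicit profiles, thresholds and radii -/

/-- The logarithmic profile `a (1 + log x⁻¹)^p`: B4 (1.21) p. 574 *"`p(e) = a₀(1 + log e⁻¹)^p`"* (regularity `|∂A| ≤ O(1) p(e)`);
B10 (7) p. 257 *"`ε₁ = g₀ p(g₀)`, where `p(g) = b₀(1 + log g⁻¹)^{p₀}`, `p₀ > 2` and `b₀` is a sufficiently large absolute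
constant"* and *"`R = R₁(1 + log g₀⁻¹)^{r₀} = R₁ r(g₀)`"*.  (B14's later profile `p₀(g) = A₀(log g⁻²)^{p₀}` WITHOUT the `1 +` is
`Setup.p0Profile`.) [cite: Balaban1985UV3, (7) p.257] -/
def oneLogProfile (a : ℝ) (p : ℕ) (x : ℝ) : ℝ := a * (1 + Real.log x⁻¹) ^ p

/-- For `0 < x ≤ 1` the logarithm `log x⁻¹` is nonnegative, so `1 + log x⁻¹ ≥ 1` (elementary API for the profile `p(g)` of
B10 (7)). [cite: Balaban1985UV3, (7) p.257] -/
private lemma one_le_one_add_log_inv {x : ℝ} (hx : 0 < x) (hx1 : x ≤ 1) : 1 ≤ 1 + Real.log x⁻¹ := by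
  have : 0 ≤ Real.log x⁻¹ := Real.log_nonneg (one_le_inv_iff₀.mpr ⟨hx, hx1⟩)
  linarith

/-- `p(x) ≥ a` on `]0, 1]` for `a ≥ 0`: the profile only ENLARGES the prefactor. [cite: Balaban1985UV3, (7) p.257] -/
lemma le_oneLogProfile {a : ℝ} (ha : 0 ≤ a) (p : ℕ) {x : ℝ} (hx : 0 < x) (hx1 : x ≤ 1) : a ≤ oneLogProfile a p x := by
  unfold oneLogProfile
  have h1 : (1 : ℝ) ≤ (1 + Real.log x⁻¹) ^ p := one_le_pow₀ (one_le_one_add_log_inv hx hx1)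
  nlinarith

/-- `p(x) > 0` on `]0, 1]` for `a > 0`. [cite: Balaban1985UV3, (7) p.257] -/
lemma oneLogProfile_pos {a : ℝ} (ha : 0 < a) (p : ℕ) {x : ℝ} (hx : 0 < x) (hx1 : x ≤ 1) : 0 < oneLogProfile a p x :=
  lt_of_lt_of_le ha (le_oneLogProfile ha.le p hx hx1)

/-- The profile is ANTITONE in `x` on `]0, 1]` (smaller coupling, larger threshold factor), `a ≥ 0`. [cite: Balaban1985UV3, (7) p.257] -/
lemma oneLogProfile_antitone {a : ℝ} (ha : 0 ≤ a) (p : ℕ) {x y : ℝ} (hx : 0 < x) (hxy : x ≤ y) (hy1 : y ≤ 1) :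
    oneLogProfile a p y ≤ oneLogProfile a p x := by
  unfold oneLogProfile
  have hy : 0 < y := lt_of_lt_of_le hx hxy
  have hlog : Real.log y⁻¹ ≤ Real.log x⁻¹ :=
    Real.log_le_log (inv_pos.mpr hy) ((inv_le_inv₀ hy hx).mpr hxy)
  have h0 : 0 ≤ 1 + Real.log y⁻¹ := (zero_le_one.trans (one_le_one_add_log_inv hy hy1))
  exact mul_le_mul_of_nonneg_left (pow_le_pow_left₀ h0 (by linarith) p) ha

/-- The length scale `L^j η` of the `j`-th lattice (the same function as `LatticeNorms.scaleLen`; repeated here as a local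
abbreviation so that this module does not depend on `LatticeNorms`).  Pre-existing decls at the locus (1.4) (v1.2
cross-reference): the domain sequences `{Ω_j}` themselves are `B8ConstraintBonds.DomainSeq` (and `B8Eq131Cubes.tcube_subset_of_sep`
uses the (1.4) separation); this is only the length `L^j η`. [cite: Balaban1985RegularSpaces, (1.4) p.77] -/
def scale (L η : ℝ) (j : ℕ) : ℝ := L ^ j * η

/-- `L^j η > 0`. [cite: Balaban1985RegularSpaces, (1.4) p.77] -/
lemma scale_pos {L η : ℝ} (hL : 0 < L) (hη : 0 < η) (j : ℕ) : 0 < scale L η j := mul_pos (pow_pos hL j) hη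

/-- B8 (1.7) p. 77, verbatim: *"`|U(∂p) − 1| < α₀ L^{−2j}` for `p ∈ Ω_j`, `j = 0, 1, …, k`"* — the plaquette threshold of the
regular space `𝔘_k({Ω_j}, α₀)` at scale `j` (unit-lattice form).  Pre-existing decls at this locus (v1.2 cross-reference): the
CONDITION `|U(∂p) − 1| < threshold` is `B8Ineq132.CondAt`/`InAk` (the space `𝔄_k`), `B8Lemma1NonAbelian.PlaqSmall/PlaqSmallLT/Small`,
`B8Lemma1Lattice.Small`; this is the threshold NUMBER on their right-hand sides. [cite: Balaban1985RegularSpaces, (1.7) p.77] -/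
def plaqThreshold (α₀ L : ℝ) (j : ℕ) : ℝ := α₀ * (L ^ (2 * j))⁻¹

/-- B8 (1.8) p. 77, verbatim: *"or `|U(∂p) − 1| < α₀ η² (L^j η)^{−2}` for `p ⊂ Ω_j`"* — the same threshold written on the
`η`-lattice (pre-existing decl at this locus: `B8Ineq132.threshold_18`, the same (1.7) = (1.8) bookkeeping inside `B8Ineq132`;
v1.2 cross-reference). [cite: Balaban1985RegularSpaces, (1.8) p.77] -/
def plaqThresholdEta (α₀ L η : ℝ) (j : ℕ) : ℝ := α₀ * η ^ 2 * (scale L η j ^ 2)⁻¹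

/-- (1.7) and (1.8) are the same number: `α₀ η² (L^j η)^{−2} = α₀ L^{−2j}` (`L, η ≠ 0`). [cite: Balaban1985RegularSpaces, (1.7) p.77] -/
lemma plaqThresholdEta_eq {L η : ℝ} (hL : L ≠ 0) (hη : η ≠ 0) (α₀ : ℝ) (j : ℕ) :
    plaqThresholdEta α₀ L η j = plaqThreshold α₀ L j := by
  unfold plaqThresholdEta plaqThreshold scale
  have hLj : L ^ j ≠ 0 := pow_ne_zero j hL
  field_simp
  ring

/-- The threshold is positive (`α₀, L > 0`). [cite: Balaban1985RegularSpaces, (1.7) p.77] -/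
lemma plaqThreshold_pos {α₀ L : ℝ} (hα : 0 < α₀) (hL : 0 < L) (j : ℕ) : 0 < plaqThreshold α₀ L j :=
  mul_pos hα (inv_pos.mpr (pow_pos hL _))

/-- The threshold DECREASES with the scale index for `L ≥ 1` (finer constraints on coarser domains `Ω_{j+1} ⊂ Ω_j`). [cite: Balaban1985RegularSpaces, (1.7) p.77] -/
lemma plaqThreshold_succ_le {α₀ L : ℝ} (hα : 0 ≤ α₀) (hL : 1 ≤ L) (j : ℕ) :
    plaqThreshold α₀ L (j + 1) ≤ plaqThreshold α₀ L j := by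
  unfold plaqThreshold
  refine mul_le_mul_of_nonneg_left ?_ hα
  have h0 : 0 < L ^ (2 * j) := pow_pos (by linarith) _
  exact (inv_le_inv₀ (pow_pos (by linarith) _) h0).mpr (pow_le_pow_right₀ hL (by omega))

/-- B8 (1.9) p. 77, verbatim: *"`|(D^{η*}_U ∂U)(b)| < α₀ L^{−2j} (L^j η)^{−1}` for `b ∈ Ω_j`, `j = 0, 1, …, k`"* — the threshold on the
covariant divergence of the plaquette field (pre-existing decls at this locus: the condition is part of `B8Ineq132.CondAt`/`InAk`,
used by `B8Prop6OfThm4.one_inAk`; v1.2 cross-reference). [cite: Balaban1985RegularSpaces, (1.9) p.77] -/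
def divThreshold (α₀ L η : ℝ) (j : ℕ) : ℝ := plaqThreshold α₀ L j * (scale L η j)⁻¹

/-- B8 (1.10) p. 77, verbatim: *"`η^{−4}[1 − Re tr U(∂p)] < α₀² (L^j η)^{−4}`, `p ∈ Ω_j`"* — the equivalent form of (1.7) through the
Wilson plaquette action density; here the right-hand side (pre-existing decls at this locus: `B8Ineq132.condAt_mono`,
`B8Ineq132.inAk_of_layers` — the sentence after (1.10); v1.2 cross-reference). [cite: Balaban1985RegularSpaces, (1.10) p.77] -/
def wilsonThreshold (α₀ L η : ℝ) (j : ℕ) : ℝ := α₀ ^ 2 * (scale L η j ^ 4)⁻¹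

/-- B11 Theorem 1 (9)–(10) p. 279, verbatim: *"`U^{u^{-1}} = e^{iηA}`, `|A| < B₃ M ε₁ (L^j η)^{−1}`, `|∇^η A| < B₃ M ε₁ (L^j η)^{−2}`,
`‖A‖_{1,β} < B₄(β₀) M ε₁ (L^j η)^{−2−β}` for `0 ≤ β ≤ β₀`, `|∂^{η*}∂^η A|, |Δ^η A| < B₃ M ε₁ (L^j η)^{−3}`"* — the regularity radii of the
minimal configurations on a cube of size `2 M L^j η`: prefactor `B · M · ε₁` times the power `−n` of the scale, `n = 1, 2, 3`, and
`2 + β` for the Hölder norm (real exponent). [cite: Balaban1985Variational, (9)–(10) p.279] -/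
def regRadius (B M ε₁ L η : ℝ) (j : ℕ) (n : ℝ) : ℝ := B * M * ε₁ * (scale L η j) ^ (-n)

/-- The regularity radii are positive for positive data. [cite: Balaban1985Variational, (9)–(10) p.279] -/
lemma regRadius_pos {B M ε₁ L η : ℝ} (hB : 0 < B) (hM : 0 < M) (hε : 0 < ε₁) (hL : 0 < L) (hη : 0 < η) (j : ℕ) (n : ℝ) :
    0 < regRadius B M ε₁ L η j n :=
  mul_pos (mul_pos (mul_pos hB hM) hε) (Real.rpow_pos_of_pos (scale_pos hL hη j) _)

/-- At the unit scale `L^j η = 1` (the `j`-th lattice in its own units) the radius is the bare `B M ε₁`, for every exponent.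
[cite: Balaban1985Variational, (9)–(10) p.279] -/
lemma regRadius_unit_scale {B M ε₁ L η : ℝ} {j : ℕ} (h : scale L η j = 1) (n : ℝ) :
    regRadius B M ε₁ L η j n = B * M * ε₁ := by
  unfold regRadius; rw [h, Real.one_rpow, mul_one]

/-- B12 (1.2) p. 260, verbatim: *"`|U(∂p) − 1| = |(∂U)(p) − 1| < ε₀ η²`, `η = L^{−k}`, `p ∈ T`, `|J| < ε₀` on `T`"* (the real space
`U_k(ε₀)`); the same shape `c ξ²` is (1.11) p. 262 *"`|∂U − 1| < α₀ ξ²` on `X`"*, (1.14) *"`|∂U − 1| < α₀ ξ²`, `|J| < γ₀` on `X`"*,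
and (1.16) *"`|∂U_n(M˙(U)) − 1| < α₀ ξ²`, `|J_n(M˙(U))| < α₀ (L^n ξ)²` on `X̃^{−2}`"* (thresholds growing back to `O(α₀)` at the
coarsest remembered scale).  `Setup.RegularSpace`/`Setup.PlaqSmall` use exactly `ε₀ * (P.eta k)^2`. [cite: Balaban1987RG1, (1.2) p.260] -/
def sqThreshold (c ξ : ℝ) : ℝ := c * ξ ^ 2

/-- B12 (1.16)–(1.17) p. 262–263: the `n`-th remembered threshold `α₀ (L^n ξ)²` is `sqThreshold α₀ (scale L ξ n)`; with
`ξ = L^{−j}` it increases with `n ≤ j` up to `α₀` at `n = j` (`L ≥ 1`). [cite: Balaban1987RG1, (1.16) p.262] -/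
lemma sqThreshold_scale_mono {α₀ L ξ : ℝ} (hα : 0 ≤ α₀) (hL : 1 ≤ L) (hξ : 0 ≤ ξ) {n n' : ℕ} (h : n ≤ n') :
    sqThreshold α₀ (scale L ξ n) ≤ sqThreshold α₀ (scale L ξ n') := by
  unfold sqThreshold scale
  refine mul_le_mul_of_nonneg_left ?_ hα
  have h1 : L ^ n * ξ ≤ L ^ n' * ξ := mul_le_mul_of_nonneg_right (pow_le_pow_right₀ hL h) hξ
  have h0 : 0 ≤ L ^ n * ξ := mul_nonneg (pow_nonneg (by linarith) _) hξ
  exact pow_le_pow_left₀ h0 h1 2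

/-- B12 (1.17) p. 263 (from Proposition 9 of [15] = B11): *"`|∂U_n(M˙(U)) − 1| < B₃ 2α'₀ L^{−2n}(L^n ξ)² = 2 B₃ α'₀ ξ²`"* — the
algebra of that display: `L^{−2n} (L^n ξ)² = ξ²` (`L ≠ 0`). [cite: Balaban1987RG1, (1.17) p.263] -/
lemma ineq117_algebra {L : ℝ} (hL : L ≠ 0) (B₃ α₀' ξ : ℝ) (n : ℕ) :
    B₃ * (2 * α₀') * (L ^ (2 * n))⁻¹ * (scale L ξ n) ^ 2 = sqThreshold (2 * B₃ * α₀') ξ := by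
  unfold scale sqThreshold
  have hLn : L ^ n ≠ 0 := pow_ne_zero n hL
  field_simp
  ring

/-- B14 p. 246, the SECOND choice of the small-field constant: *"we take `ε₀ = g₀ A₀ (log γ₀⁻²)^{p₀}`, `γ₀⁻² = γ⁻² + β log ε⁻¹`,
`β, γ > 0`"* — the coupling-independent substitute `γ₀⁻²` for `g₀⁻²` (B14 "(0.33) [I]"); the first choice
`ε₀ = g₀ p₀(g₀)` is `Setup.epsK`. [cite: Balaban1988Convergent, p.246] -/
def gammaZeroInvSq (γ β ε : ℝ) : ℝ := (γ ^ 2)⁻¹ + β * Real.log ε⁻¹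

/-- `γ₀⁻² ≥ γ⁻²` for `β ≥ 0` and `ε ≤ 1` (so `γ₀ ≤ γ`: the substitute threshold is smaller). [cite: Balaban1988Convergent, p.246] -/
lemma inv_sq_le_gammaZeroInvSq {γ β ε : ℝ} (hβ : 0 ≤ β) (hε : 0 < ε) (hε1 : ε ≤ 1) : (γ ^ 2)⁻¹ ≤ gammaZeroInvSq γ β ε := by
  unfold gammaZeroInvSq
  have : 0 ≤ Real.log ε⁻¹ := Real.log_nonneg (one_le_inv_iff₀.mpr ⟨hε, hε1⟩)
  nlinarith

end

/-! ## 4. (v1.3) The dependence signatures of the (Higgs)₂,₃ papers B1, B3 -/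

/-- Dependence signature "on `d` and `a`" — `a` the positive parameter of the renormalization transformation `T_{a,L}` of the
(Higgs)₂,₃ papers (B1 (1.20) p. 607; `a_k` in (2.20) p. 610): B1 Prop. 2.3 p. 611, verbatim *"positive constants `δ₀, c₀, γ₀, γ₁`,
dependent on `d` and `a`, and independent of `A, k, Ω` and `Λ`"*.  Pre-existing statement at this locus: `B1.Prop23Literal`
(constants existential inside). [cite: Balaban1982Higgs1, Prop. 2.3 p.611] -/
structure SigDA where
  /-- the dimension `d` -/
  d : ℕ
  /-- the averaging parameter `a > 0` -/
  a : ℝ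

/-- Dependence signature "on `d, a, M` only": B1 Prop. 2.1 p. 610, verbatim *"there exist positive constants `δ₀, c₀, R₀` independent of
`A, k, Ω` and depending on `d, a, M` only, `c₀` on `α` also"*; Prop. 2.2 p. 611 *"depending on the same quantities as in
Proposition 2.1"*.  B4's restatement of Prop. 2.1 (Theorem p. 573) prints "depending on `d, M` only" — the `a`-dependence is
dropped there (`a` fixed; cell divergence D-pv07.1 recorded in `B1.lean`), whence `SigDAM.toSigDM` below and `SigDM` above.
Pre-existing statements at this locus: `B1.Prop21Printed`, `B1.Prop21Uniform` (= `B4.ThmPrinted` by `B1.prop21Printed_iff_thmPrinted`).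
[cite: Balaban1982Higgs1, Prop. 2.1 p.610] -/
structure SigDAM where
  /-- the dimension `d` -/
  d : ℕ
  /-- the averaging parameter `a > 0` -/
  a : ℝ
  /-- the big-block size `M` -/
  M : ℕ

/-- Forgetting `a` (B4's reading of the same constants, "`d, M` only"). [cite: Balaban1982Higgs1, Prop. 2.1 p.610] -/
def SigDAM.toSigDM (s : SigDAM) : SigDM := ⟨s.d, s.M⟩

/-- Forgetting `M`. [cite: Balaban1982Higgs1, Prop. 2.3 p.611] -/
def SigDAM.toSigDA (s : SigDAM) : SigDA := ⟨s.d, s.a⟩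

/-- Forgetting `a`: a constant "depending on `d` only" (B3 Prop. 1: *"in estimates we always assume that `a = 1`"*) read over `(d, a)`.
[cite: Balaban1983Higgs3, Proposition 1 p.420] -/
def SigDA.toSigD (s : SigDA) : SigD := ⟨s.d⟩

/-- Reading a range-restricted constant along a change of signature (the `PosConstOn` analogue of `PosConst.comap`).
[cite: Balaban1982Higgs1, Prop. 2.1 p.610] -/
def PosConstOn.comap {σ τ : Type*} {ok : ℝ → Prop} (c : PosConstOn σ ok) (f : τ → σ) : PosConstOn τ ok :=
  ⟨fun t x => c.val (f t) x, fun t x hx => c.pos (f t) x hx⟩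

/-- B1 Proposition 2.1 p. 610, the constants with their printed dependence: *"for `e(L^k ε)` sufficiently small and `α < 1` there exist
positive constants `δ₀, c₀, R₀` independent of `A, k, Ω` and depending on `d, a, M` only, `c₀` on `α` also"*; (2.23): *"`c` is some
universal constant"* (the regularity threshold `|∂A| ≤ c (e(L^k ε))^{β−1}`, `e(L^k ε) = e (L^k ε)^{(4−d)/2}`, `β > 0`).  The statement is the
pre-existing `B1.Prop21Printed` / `B1.Prop21Uniform` (the finer reading: `δ₀, R₀` before `α`, `c₀` after — exactly the field types below).
[cite: Balaban1982Higgs1, Prop. 2.1 (2.23)–(2.26) p.610] -/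
structure B1Prop21Consts where
  /-- the decay rate `δ₀(d, a, M)` -/
  δ₀ : PosConst SigDAM
  /-- the boundary-distance threshold `R₀(d, a, M)` of `dist({x, x'}, Ωᶜ) ≥ R₀` -/
  R₀ : PosConst SigDAM
  /-- the prefactor `c₀(d, a, M; α)`, `α < 1` -/
  c₀ : PosConstOn SigDAM HolderRange

/-- B4's Theorem p. 573 is B1's Prop. 2.1 with `a` fixed: the `(d, M)`-signature bundle obtained by freezing `a`.
[cite: Balaban1982Higgs1, Prop. 2.1 p.610] -/
def B1Prop21Consts.atParam (C : B1Prop21Consts) (a : ℝ) : B4ThmConsts where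
  δ₀ := C.δ₀.comap fun s => ⟨s.d, a, s.M⟩
  R₀ := C.R₀.comap fun s => ⟨s.d, a, s.M⟩
  c₀ := C.c₀.comap fun s => ⟨s.d, a, s.M⟩

/-- Freezing `a` does not change the values. [cite: Balaban1982Higgs1, Prop. 2.1 p.610] -/
lemma B1Prop21Consts.atParam_δ₀ (C : B1Prop21Consts) (a : ℝ) (s : SigDM) :
    (C.atParam a).δ₀.val s = C.δ₀.val ⟨s.d, a, s.M⟩ := rfl

/-- B1 Proposition 2.2 p. 611, verbatim: *"there exist constants `δ₀ > 0` and `c₀`, depending on the same quantities as in Proposition 2.1,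
such that `|Δ^{(k)}(Ω, A; x, x')| ≤ c₀ exp(−δ₀|x − x'|)`"* (2.27) (and (2.29) for `δΔ^{(k)}`).  `c₀ > 0` is harmless (a bound).  Statement:
pre-existing `B1.Prop22Literal`. [cite: Balaban1982Higgs1, Prop. 2.2 (2.27)–(2.29) p.611] -/
structure B1Prop22Consts where
  /-- the decay rate `δ₀(d, a, M) > 0` -/
  δ₀ : PosConst SigDAM
  /-- the prefactor `c₀(d, a, M)` -/
  c₀ : PosConst SigDAM

/-- B1 Proposition 2.3 p. 611, verbatim: *"there exist positive constants `δ₀, c₀, γ₀, γ₁`, dependent on `d` and `a`, and independent of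
`A, k, Ω` and `Λ`, such that `γ₀ I ≤ a L^{−2} P(A) + Δ^{(k)}(Ω, A) ≤ γ₁ I`"* (2.33), kernel decay (2.34)–(2.38) (the sentence and
(2.33)–(2.35) are printed on p. 611, (2.36)–(2.38) on p. 612).  (B4 Prop. 2.3 p. 574 prints "dependent on `d` and `M` only" for its
version — `B4Prop23Consts` above; the two sentences differ in print and are both recorded.)
Statement: pre-existing `B1.Prop23Literal` / `B4.Prop23Printed`. [cite: Balaban1982Higgs1, Prop. 2.3 (2.33)–(2.38) pp.611–612] -/
structure B1Prop23Consts where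
  /-- the decay rate `δ₀(d, a)` -/
  δ₀ : PosConst SigDA
  /-- the prefactor `c₀(d, a)` -/
  c₀ : PosConst SigDA
  /-- the lower form bound `γ₀(d, a)` of (2.33) -/
  γ₀ : PosConst SigDA
  /-- the upper form bound `γ₁(d, a)` of (2.33) -/
  γ₁ : PosConst SigDA
  /-- `γ₀ ≤ γ₁` ((2.33) is a sandwich) -/
  γ₀_le_γ₁ : ∀ s, γ₀.val s ≤ γ₁.val s

/-- B3 Proposition 1 pp. 420–421, the constant sentences verbatim: *"There exist positive constants `δ₀`, `O(1)` such that"* (1.33) holds,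
*"where `0 < α₀ < 1` … The constant `δ₀` depends on the dimension `d` only (in estimates we always assume that `a = 1` in the definition
of the renormalization transformation and `M` is fixed in an optimal way, i.e. the smallest possible). The constant `O(1)` depends on
`α₀, n̄` (in fact on `n̄` only if `α₀` is chosen not too close to `0`, e.g. if we take `α₀ = ½`), and is independent of `ε, k`, the domains
`Ω, Ω₁, Ω₂`, the vector field `B̃`"*.  Typed: `δ₀ : PosConst SigD`; `O1` a positive function of `(d, n̄)` and of `α₀` on its printed range
`0 < α₀ < 1` (`EpsRange` is that open interval).  Statement: pre-existing `B3Prop1.Prop1` (`∃ δ₀ > 0, ∀ α₀ ∈ (0,1), ∀ n̄, ∃ C > 0, …` — the same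
order of dependence). [cite: Balaban1983Higgs3, Proposition 1 (1.33) pp.420–421] -/
structure B3Prop1Consts where
  /-- the tree-decay rate `δ₀(d)` -/
  δ₀ : PosConst SigD
  /-- the prefactor `O(1)(d, n̄; α₀)`, `0 < α₀ < 1` (`n̄` = the perturbation order) -/
  O1 : PosConstOn (SigD × ℕ) EpsRange

end SeriesConstants

end Literature.MathematicalPhysics.QuantumFieldTheory.Balaban1983to89
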